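import Literature.Analysis.Calculus.SpherePoincareVector
import Literature.Analysis.Calculus.SphereDivergence
import HarnessLib

/-!
# Means of tangential vector fields on spheres and the gap `n − 1` up to a divergence term

Analysis support file (everything proved; no definitions, no named facts) for the `S³` spectral
input of A. Waldron, Invent. math. 217 (2019), Lemma 3.5(a) in the `u = ⋆(x ∧ F)` formalism.
For a family `u_a : ℝⁿ → V` (`a ∈ Fin n`, `V` a finite-dimensional inner product space), `C²`
off the origin and **tangential** (`∑ₐ ⟨x, e_a⟩ u_a(x) = 0`), the means over `S_r` are controlled
by the flat divergence `w = ∑ₐ ∂_{e_a} u_a`, so that the sharp Poincaré inequality gives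
`(n−1) ∑ₐ ∮‖u_a‖² ≤ ½∑ᵢⱼ∑ₐ ∮‖Du_a(L_{ij})‖² + (n−1) r² ∮‖w‖²` (`sphere_gap_tangential`): for a
divergence-free tangential family the gap is the full `n − 1` (`= 3` on `S³`), which is the
first eigenvalue `4` of the Hodge Laplacian on closed 2-forms of `S³` in the 2-form language.

* `sphereIntegral_sq_le`, `norm_sphereIntegral_sq_le` — Cauchy–Schwarz for sphere means;
* `sphereIntegral_inner_tangential_eq` — `∮_{S_r}⟨X, e_m⟩ = −∮_{S_r} ⟨x,e_m⟩ div X` for a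
  tangential `C¹` field (from the tree's `sphereIntegral_div_sub_eq_zero`);
* `sphere_gap_tangential`.

References: A. Waldron, Invent. math. 217 (2019), Lemma 3.5 [Waldron2019]; [folklore].
-/

noncomputable section

open scoped BigOperators RealInnerProductSpace
open MeasureTheory Metric Set
open Literature.Analysis.FluidPDE Literature.Analysis.Calculus

namespace Literature.Analysis.Calculus.MvPoly

variable {n : ℕ}

local notation "𝔼" => EuclideanSpace ℝ (Fin n)
local notation "𝕓" => EuclideanSpace.basisFun (Fin n) ℝ

section CauchySchwarz

/-- **Cauchy–Schwarz for sphere means** (scalar): `(∮f)² ≤ ∮1 · ∮f²`. [folklore] -/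
theorem sphereIntegral_sq_le [Nontrivial 𝔼] {f : 𝔼 → ℝ} (hf : ContinuousOn f {0}ᶜ) {r : ℝ}
    (hr : 0 < r) :
    (sphereIntegral (volume : Measure 𝔼) f r) ^ 2 ≤
      sphereIntegral (volume : Measure 𝔼) (fun _ => (1 : ℝ)) r *
        sphereIntegral (volume : Measure 𝔼) (fun x => f x ^ 2) r := by
  set I1 := sphereIntegral (volume : Measure 𝔼) (fun _ => (1 : ℝ)) r with hI1
  set If := sphereIntegral (volume : Measure 𝔼) f r with hIf
  set Iff := sphereIntegral (volume : Measure 𝔼) (fun x => f x ^ 2) r with hIff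
  have h1 : 0 < I1 := sphereIntegral_one_pos r
  set c : ℝ := If / I1 with hc
  -- `0 ≤ ∮ (f − c)² = ∮f² − 2c∮f + c²∮1`
  have hnn : 0 ≤ sphereIntegral (volume : Measure 𝔼) (fun x => (f x - c) ^ 2) r :=
    sphereIntegral_nonneg' (fun x => sq_nonneg _) r
  have hexp : sphereIntegral (volume : Measure 𝔼) (fun x => (f x - c) ^ 2) r =
      Iff - 2 * c * If + c ^ 2 * I1 := by
    have heq : (fun x : 𝔼 => (f x - c) ^ 2) = fun x => (f x ^ 2 - 2 * c * f x) + c ^ 2 * 1 := by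
      funext x; ring
    rw [heq, sphereIntegral_add_of (fun x => f x ^ 2 - 2 * c * f x) (fun _ => c ^ 2 * 1)
        ((hf.pow 2).sub (continuousOn_const.mul hf)) continuousOn_const hr,
      sphereIntegral_sub_of (fun x => f x ^ 2) (fun x => 2 * c * f x) (hf.pow 2)
        (continuousOn_const.mul hf) hr,
      sphereIntegral_mul_left, sphereIntegral_mul_left]
  rw [hexp] at hnn
  have hkey : Iff - 2 * c * If + c ^ 2 * I1 = Iff - If ^ 2 / I1 := by
    rw [hc]; field_simp; ring
  rw [hkey] at hnn
  have h2 : If ^ 2 / I1 ≤ Iff := by linarith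
  rwa [div_le_iff₀ h1, mul_comm] at h2

variable {V : Type*} [NormedAddCommGroup V] [InnerProductSpace ℝ V] [FiniteDimensional ℝ V]

/-- **Cauchy–Schwarz for sphere means** (vector-valued): `‖∮g‖² ≤ ∮1 · ∮‖g‖²`. [folklore] -/
theorem norm_sphereIntegral_sq_le [Nontrivial 𝔼] {g : 𝔼 → V} (hg : ContinuousOn g {0}ᶜ) {r : ℝ}
    (hr : 0 < r) :
    ‖sphereIntegral (volume : Measure 𝔼) g r‖ ^ 2 ≤
      sphereIntegral (volume : Measure 𝔼) (fun _ => (1 : ℝ)) r *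
        sphereIntegral (volume : Measure 𝔼) (fun x => ‖g x‖ ^ 2) r := by
  set e := stdOrthonormalBasis ℝ V with he
  have hgk : ∀ k, ContinuousOn (fun x => ⟪g x, e k⟫) {0}ᶜ := fun k => hg.inner continuousOn_const
  rw [← e.sum_sq_inner_left]
  simp_rw [← sphereIntegral_inner_const hg hr]
  have hP : sphereIntegral (volume : Measure 𝔼) (fun x => ‖g x‖ ^ 2) r =
      ∑ k, sphereIntegral (volume : Measure 𝔼) (fun x => ⟪g x, e k⟫ ^ 2) r := by
    rw [← sphereIntegral_finset_sum Finset.univ (g := fun k x => ⟪g x, e k⟫ ^ 2)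
      (fun k _ => (hgk k).pow 2) hr]
    exact sphereIntegral_congr_norm hr.le fun x _ => (e.sum_sq_inner_left (g x)).symm
  rw [hP, Finset.mul_sum]
  exact Finset.sum_le_sum fun k _ => sphereIntegral_sq_le (hgk k) hr

end CauchySchwarz

section Tangential

/-- **Components of a tangential field integrate against the divergence**: for a `C¹` vector
field `X` off the origin with `⟨X(x), x⟩ = 0` and `r > 0`,
`∮_{S_r} ⟨X, e_m⟩ = −∮_{S_r} ⟨x, e_m⟩ div X` (the sphere divergence theorem applied to
`⟨x, e_m⟩ X`; for tangential `X` the flat divergence restricts to `div_{S_r}`). [folklore] -/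
theorem sphereIntegral_inner_tangential_eq [Nontrivial 𝔼] {X : 𝔼 → 𝔼} (hX : ContDiffOn ℝ 1 X {0}ᶜ)
    (htan : ∀ x, ⟪X x, x⟫ = 0) {r : ℝ} (hr : 0 < r) (m : Fin n) :
    sphereIntegral (volume : Measure 𝔼) (fun x => ⟪X x, 𝕓 m⟫) r =
      -sphereIntegral (volume : Measure 𝔼)
        (fun x => ⟪x, 𝕓 m⟫ * ∑ k, ⟪fderiv ℝ X x (𝕓 k), 𝕓 k⟫) r := by
  classical
  have hO : IsOpen ({0}ᶜ : Set 𝔼) := isOpen_compl_singleton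
  have hXd : ∀ x ∈ ({0}ᶜ : Set 𝔼), DifferentiableAt ℝ X x := fun x hx =>
    (hX.differentiableOn one_ne_zero).differentiableAt (hO.mem_nhds hx)
  -- the field `Y = ⟨x, e_m⟩ X`
  set Y : 𝔼 → 𝔼 := fun x => ⟪x, 𝕓 m⟫ • X x with hY
  have hlin : ContDiff ℝ 1 fun x : 𝔼 => ⟪x, 𝕓 m⟫ := (contDiff_id.inner ℝ contDiff_const)
  have hYs : ContDiffOn ℝ 1 Y {0}ᶜ := hlin.contDiffOn.smul hX
  have hdlin : ∀ x v : 𝔼, fderiv ℝ (fun y : 𝔼 => ⟪y, 𝕓 m⟫) x v = ⟪v, 𝕓 m⟫ := fun x v => by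
    rw [fderiv_inner_apply ℝ differentiableAt_fun_id (differentiableAt_const _)]
    simp [fderiv_fun_const]
  have hDY : ∀ x ∈ ({0}ᶜ : Set 𝔼), ∀ v, fderiv ℝ Y x v = ⟪v, 𝕓 m⟫ • X x + ⟪x, 𝕓 m⟫ • fderiv ℝ X x v := by
    intro x hx v
    rw [hY, fderiv_fun_smul (hlin.differentiable one_ne_zero x) (hXd x hx)]
    simp only [FunLike.coe_add, Pi.add_apply, smul_apply, ContinuousLinearMap.smulRight_apply, hdlin]
    rw [add_comm]
  -- derivative of the tangency relation along `x`: `⟨DX(x)x, x⟩ = 0`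
  have hDXxx : ∀ x ∈ ({0}ᶜ : Set 𝔼), ⟪fderiv ℝ X x x, x⟫ = 0 := by
    intro x hx
    have h0 : (fun y : 𝔼 => ⟪X y, y⟫) = fun _ => 0 := funext htan
    have hd : fderiv ℝ (fun y : 𝔼 => ⟪X y, y⟫) x x = ⟪fderiv ℝ X x x, x⟫ + ⟪X x, x⟫ := by
      rw [fderiv_inner_apply ℝ (hXd x hx) differentiableAt_fun_id]
      simp only [fderiv_fun_id, ContinuousLinearMap.id_apply]
      rw [add_comm]
    rw [h0] at hd
    simp only [fderiv_fun_const, Pi.zero_apply, FunLike.coe_zero] at hd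
    linarith [htan x]
  have h := sphereIntegral_div_sub_eq_zero 𝕓 hYs hr
  -- evaluate the integrand of the divergence identity for `Y`
  have hint : ∀ x, ‖x‖ = r →
      ‖x‖ ^ 2 * ∑ k, ⟪fderiv ℝ Y x (𝕓 k), 𝕓 k⟫ - ⟪fderiv ℝ Y x x, x⟫ -
        ((Fintype.card (Fin n) : ℝ) - 1) * ⟪Y x, x⟫ =
      r ^ 2 * (⟪X x, 𝕓 m⟫ + ⟪x, 𝕓 m⟫ * ∑ k, ⟪fderiv ℝ X x (𝕓 k), 𝕓 k⟫) := by
    intro x hx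
    have hx0 : x ∈ ({0}ᶜ : Set 𝔼) := by
      have : x ≠ 0 := fun h0 => by rw [h0, norm_zero] at hx; exact hr.ne' hx.symm
      exact mem_compl_singleton_iff.2 this
    have hsum : ∑ k, ⟪fderiv ℝ Y x (𝕓 k), 𝕓 k⟫ =
        ⟪X x, 𝕓 m⟫ + ⟪x, 𝕓 m⟫ * ∑ k, ⟪fderiv ℝ X x (𝕓 k), 𝕓 k⟫ := by
      simp_rw [hDY x hx0, inner_add_left, inner_smul_left, RCLike.conj_to_real,
        Finset.sum_add_distrib, ← Finset.mul_sum]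
      congr 1
      -- `∑_k ⟨e_k, e_m⟩⟨X, e_k⟩ = ⟨X, e_m⟩`
      have hon : ∀ k, ⟪𝕓 k, 𝕓 m⟫ = if k = m then (1 : ℝ) else 0 := fun k =>
        orthonormal_iff_ite.1 (EuclideanSpace.basisFun (Fin n) ℝ).orthonormal k m
      simp_rw [hon, ite_mul, one_mul, zero_mul, Finset.sum_ite_eq', Finset.mem_univ, if_true]
    have h2 : ⟪fderiv ℝ Y x x, x⟫ = 0 := by
      rw [hDY x hx0, inner_add_left, inner_smul_left, inner_smul_left, htan x, hDXxx x hx0]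
      simp
    have h3 : ⟪Y x, x⟫ = 0 := by rw [hY]; simp only [inner_smul_left, htan x, mul_zero]
    rw [hsum, h2, h3, hx]
    ring
  rw [sphereIntegral_congr_norm hr.le hint, sphereIntegral_mul_left] at h
  have hr2 : r ^ 2 ≠ 0 := pow_ne_zero 2 hr.ne'
  have h' : sphereIntegral (volume : Measure 𝔼)
      (fun x => ⟪X x, 𝕓 m⟫ + ⟪x, 𝕓 m⟫ * ∑ k, ⟪fderiv ℝ X x (𝕓 k), 𝕓 k⟫) r = 0 := by
    rcases mul_eq_zero.1 h with h1 | h1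
    · exact absurd h1 hr2
    · exact h1
  have hc1 : ContinuousOn (fun x => ⟪X x, 𝕓 m⟫) {0}ᶜ := hX.continuousOn.inner continuousOn_const
  have hc2 : ContinuousOn (fun x : 𝔼 => ⟪x, 𝕓 m⟫ * ∑ k, ⟪fderiv ℝ X x (𝕓 k), 𝕓 k⟫) {0}ᶜ := by
    refine (continuous_id.inner continuous_const).continuousOn.mul ?_
    refine continuousOn_finsetSum _ fun k _ => ?_
    exact ((hX.continuousOn_fderiv_of_isOpen hO le_rfl).clm_apply continuousOn_const).inner
      continuousOn_const
  rw [sphereIntegral_add_of _ _ hc1 hc2 hr] at h'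
  linarith

end Tangential

section Gap

variable {V : Type*} [NormedAddCommGroup V] [InnerProductSpace ℝ V] [FiniteDimensional ℝ V]

/-- **The gap `n − 1` for tangential families, up to the divergence**: for `u_a : ℝⁿ → V`
(`a ∈ Fin n`), `C²` off the origin and tangential (`∑ₐ ⟨x, e_a⟩ u_a(x) = 0`), and `r > 0`,
`(n−1) ∑ₐ ∮_{S_r}‖u_a‖² ≤ ½∑ᵢⱼ∑ₐ ∮_{S_r}‖Du_a(L_{ij})‖² + (n−1) r² ∮_{S_r}‖∑ₐ ∂_{e_a}u_a‖²`.
[folklore] -/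
theorem sphere_gap_tangential (hn : 2 ≤ n) {u : Fin n → 𝔼 → V}
    (hu : ∀ a, ContDiffOn ℝ 2 (u a) {0}ᶜ) (htan : ∀ x : 𝔼, ∑ a, ⟪x, 𝕓 a⟫ • u a x = 0)
    {r : ℝ} (hr : 0 < r) :
    ((n : ℝ) - 1) * ∑ a, sphereIntegral (volume : Measure 𝔼) (fun x => ‖u a x‖ ^ 2) r ≤
      (1 / 2) * ∑ i, ∑ j, ∑ a, sphereIntegral (volume : Measure 𝔼)
          (fun x => ‖fderiv ℝ (u a) x (angularField 𝕓 i j x)‖ ^ 2) r +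
        ((n : ℝ) - 1) * r ^ 2 * sphereIntegral (volume : Measure 𝔼)
          (fun x => ‖∑ a, fderiv ℝ (u a) x (𝕓 a)‖ ^ 2) r := by
  haveI : Nontrivial 𝔼 := by
    haveI : Nonempty (Fin n) := ⟨⟨0, by omega⟩⟩
    infer_instance
  have hO : IsOpen ({0}ᶜ : Set 𝔼) := isOpen_compl_singleton
  set e := stdOrthonormalBasis ℝ V with he
  set w : 𝔼 → V := fun x => ∑ a, fderiv ℝ (u a) x (𝕓 a) with hw
  have huc : ∀ a, ContinuousOn (u a) {0}ᶜ := fun a => (hu a).continuousOn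
  have hud : ∀ a, ∀ x ∈ ({0}ᶜ : Set 𝔼), DifferentiableAt ℝ (u a) x := fun a x hx =>
    ((hu a).differentiableOn (by norm_num)).differentiableAt (hO.mem_nhds hx)
  have hDuc : ∀ a (v : 𝔼), ContinuousOn (fun x => fderiv ℝ (u a) x v) {0}ᶜ := fun a v =>
    ((hu a).continuousOn_fderiv_of_isOpen hO (by norm_num)).clm_apply continuousOn_const
  have hwc : ContinuousOn w {0}ᶜ := continuousOn_finsetSum _ fun a _ => hDuc a (𝕓 a)
  -- ### the tangential fields `X_k = ∑ₐ ⟨u_a, ε_k⟩ e_a`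
  set X : Fin (Module.finrank ℝ V) → 𝔼 → 𝔼 := fun k x => ∑ a, ⟪u a x, e k⟫ • 𝕓 a with hX
  have hXs : ∀ k, ContDiffOn ℝ 1 (X k) {0}ᶜ := fun k =>
    ContDiffOn.sum fun a _ => (((hu a).of_le (by norm_num)).inner ℝ contDiffOn_const).smul
      contDiffOn_const
  have hXtan : ∀ k x, ⟪X k x, x⟫ = 0 := by
    intro k x
    simp only [hX, sum_inner, inner_smul_left, RCLike.conj_to_real]
    have h := congrArg (fun z : V => ⟪z, e k⟫) (htan x)
    simp only [sum_inner, inner_smul_left, RCLike.conj_to_real, inner_zero_left] at h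
    rw [← h]
    refine Finset.sum_congr rfl fun a _ => ?_
    rw [real_inner_comm (𝕓 a) x]; ring
  have hon : ∀ a m, ⟪𝕓 a, 𝕓 m⟫ = if a = m then (1 : ℝ) else 0 := fun a m =>
    orthonormal_iff_ite.1 (EuclideanSpace.basisFun (Fin n) ℝ).orthonormal a m
  have hXcomp : ∀ k m x, ⟪X k x, 𝕓 m⟫ = ⟪u m x, e k⟫ := by
    intro k m x
    simp only [hX, sum_inner, inner_smul_left, RCLike.conj_to_real, hon, mul_ite, mul_one,
      mul_zero, Finset.sum_ite_eq', Finset.mem_univ, if_true]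
  have hXdiv : ∀ k, ∀ x ∈ ({0}ᶜ : Set 𝔼), ∑ k', ⟪fderiv ℝ (X k) x (𝕓 k'), 𝕓 k'⟫ = ⟪w x, e k⟫ := by
    intro k x hx
    have hD : ∀ v, fderiv ℝ (X k) x v = ∑ a, ⟪fderiv ℝ (u a) x v, e k⟫ • 𝕓 a := by
      intro v
      have hterm : ∀ a, HasFDerivAt (fun y => ⟪u a y, e k⟫ • 𝕓 a)
          ((ContinuousLinearMap.smulRight
            ((innerSL ℝ (e k) : V →L[ℝ] ℝ).comp (fderiv ℝ (u a) x)) (𝕓 a))) x := by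
        intro a
        have h1 : HasFDerivAt (fun y => ⟪u a y, e k⟫)
            ((innerSL ℝ (e k) : V →L[ℝ] ℝ).comp (fderiv ℝ (u a) x)) x := by
          have h := ((hud a x hx).hasFDerivAt).inner ℝ (hasFDerivAt_const (e k) x)
          refine h.congr_fderiv (ContinuousLinearMap.ext fun y => ?_)
          simp [fderivInnerCLM_apply, innerSL_apply_apply, real_inner_comm]
        exact h1.smul_const (𝕓 a)
      have hsum := HasFDerivAt.fun_sum fun a (_ : a ∈ Finset.univ) => hterm a
      rw [show X k = fun y => ∑ a, ⟪u a y, e k⟫ • 𝕓 a from rfl, hsum.fderiv]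
      simp only [FunLike.coe_sum, Finset.sum_apply, ContinuousLinearMap.smulRight_apply,
        ContinuousLinearMap.comp_apply, innerSL_apply_apply]
      refine Finset.sum_congr rfl fun a _ => ?_
      rw [real_inner_comm]
    simp only [hD, sum_inner, inner_smul_left, RCLike.conj_to_real, hon, mul_ite, mul_one, mul_zero,
      Finset.sum_ite_eq', Finset.mem_univ, if_true]
    rw [hw, sum_inner]
  -- ### the mean identity `⟨∮u_m, ε_k⟩ = −⟨∮ x_m w, ε_k⟩`
  have hmean : ∀ m k, ⟪sphereIntegral (volume : Measure 𝔼) (u m) r, e k⟫ =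
      -⟪sphereIntegral (volume : Measure 𝔼) (fun x => ⟪x, 𝕓 m⟫ • w x) r, e k⟫ := by
    intro m k
    have hcm : ContinuousOn (fun x : 𝔼 => ⟪x, 𝕓 m⟫ • w x) {0}ᶜ :=
      (continuous_id.inner continuous_const).continuousOn.smul hwc
    rw [← sphereIntegral_inner_const (huc m) hr, ← sphereIntegral_inner_const hcm hr]
    have h := sphereIntegral_inner_tangential_eq (hXs k) (hXtan k) hr m
    have hl : sphereIntegral (volume : Measure 𝔼) (fun x => ⟪X k x, 𝕓 m⟫) r =
        sphereIntegral (volume : Measure 𝔼) (fun x => ⟪u m x, e k⟫) r :=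
      sphereIntegral_congr_norm hr.le fun x _ => hXcomp k m x
    have hrt : sphereIntegral (volume : Measure 𝔼)
        (fun x => ⟪x, 𝕓 m⟫ * ∑ k', ⟪fderiv ℝ (X k) x (𝕓 k'), 𝕓 k'⟫) r =
        sphereIntegral (volume : Measure 𝔼) (fun x => ⟪⟪x, 𝕓 m⟫ • w x, e k⟫) r := by
      refine sphereIntegral_congr_norm hr.le fun x hx => ?_
      have hx0 : x ∈ ({0}ᶜ : Set 𝔼) := by
        have : x ≠ 0 := fun h0 => by rw [h0, norm_zero] at hx; exact hr.ne' hx.symm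
        exact mem_compl_singleton_iff.2 this
      rw [hXdiv k x hx0, inner_smul_left, RCLike.conj_to_real]
    rw [hl, hrt] at h
    exact h
  -- ### `∑ₘ ‖∮u_m‖² ≤ ∮1 · r² ∮‖w‖²`
  have hmean_sq : ∀ m, ‖sphereIntegral (volume : Measure 𝔼) (u m) r‖ ^ 2 =
      ‖sphereIntegral (volume : Measure 𝔼) (fun x => ⟪x, 𝕓 m⟫ • w x) r‖ ^ 2 := by
    intro m
    rw [← e.sum_sq_inner_left, ← e.sum_sq_inner_left]
    refine Finset.sum_congr rfl fun k _ => ?_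
    rw [hmean m k, neg_sq]
  set I1 := sphereIntegral (volume : Measure 𝔼) (fun _ => (1 : ℝ)) r with hI1
  have hI1pos : 0 < I1 := sphereIntegral_one_pos r
  have hMB : ∑ m, ‖sphereIntegral (volume : Measure 𝔼) (u m) r‖ ^ 2 ≤
      I1 * (r ^ 2 * sphereIntegral (volume : Measure 𝔼) (fun x => ‖w x‖ ^ 2) r) := by
    have h1 : ∀ m, ‖sphereIntegral (volume : Measure 𝔼) (u m) r‖ ^ 2 ≤
        I1 * sphereIntegral (volume : Measure 𝔼) (fun x => ‖⟪x, 𝕓 m⟫ • w x‖ ^ 2) r := by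
      intro m
      rw [hmean_sq m]
      exact norm_sphereIntegral_sq_le ((continuous_id.inner continuous_const).continuousOn.smul hwc) hr
    refine (Finset.sum_le_sum fun m _ => h1 m).trans ?_
    rw [← Finset.mul_sum]
    refine mul_le_mul_of_nonneg_left (le_of_eq ?_) hI1pos.le
    have hcm : ∀ m, ContinuousOn (fun x : 𝔼 => ‖⟪x, 𝕓 m⟫ • w x‖ ^ 2) {0}ᶜ := fun m =>
      (((continuous_id.inner continuous_const).continuousOn.smul hwc).norm).pow 2
    rw [← sphereIntegral_finset_sum Finset.univ (g := fun m x => ‖⟪x, 𝕓 m⟫ • w x‖ ^ 2)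
      (fun m _ => hcm m) hr, ← sphereIntegral_mul_left]
    refine sphereIntegral_congr_norm hr.le fun x hx => ?_
    simp_rw [norm_smul, mul_pow, ← Finset.sum_mul, Real.norm_eq_abs, sq_abs]
    rw [(EuclideanSpace.basisFun (Fin n) ℝ).sum_sq_inner_left x, hx]
  -- ### add up the Poincaré inequalities
  have hP := fun a => sharp_poincare_sphere_vector hn (hu a) hr
  have hsum := Finset.sum_le_sum fun a (_ : a ∈ Finset.univ) => hP a
  have hn1 : (0 : ℝ) ≤ (n : ℝ) - 1 := by
    have : (2 : ℝ) ≤ n := by exact_mod_cast hn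
    linarith
  have hdiv : ((n : ℝ) - 1) * (∑ m, ‖sphereIntegral (volume : Measure 𝔼) (u m) r‖ ^ 2) / I1 ≤
      ((n : ℝ) - 1) * r ^ 2 * sphereIntegral (volume : Measure 𝔼) (fun x => ‖w x‖ ^ 2) r := by
    rw [mul_div_assoc, mul_assoc]
    refine mul_le_mul_of_nonneg_left ?_ hn1
    rw [div_le_iff₀ hI1pos]
    calc ∑ m, ‖sphereIntegral (volume : Measure 𝔼) (u m) r‖ ^ 2
        ≤ I1 * (r ^ 2 * sphereIntegral (volume : Measure 𝔼) (fun x => ‖w x‖ ^ 2) r) := hMB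
      _ = r ^ 2 * sphereIntegral (volume : Measure 𝔼) (fun x => ‖w x‖ ^ 2) r * I1 := by ring
  have hL : ∑ a, ((n : ℝ) - 1) * (sphereIntegral (volume : Measure 𝔼) (fun x => ‖u a x‖ ^ 2) r -
      ‖sphereIntegral (volume : Measure 𝔼) (u a) r‖ ^ 2 / I1) =
      ((n : ℝ) - 1) * ∑ a, sphereIntegral (volume : Measure 𝔼) (fun x => ‖u a x‖ ^ 2) r -
        ((n : ℝ) - 1) * (∑ m, ‖sphereIntegral (volume : Measure 𝔼) (u m) r‖ ^ 2) / I1 := by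
    simp only [mul_sub, Finset.sum_sub_distrib, ← Finset.mul_sum, Finset.sum_div, mul_div_assoc]
  have hRsum : ∑ a, (1 / 2) * ∑ i, ∑ j, sphereIntegral (volume : Measure 𝔼)
      (fun x => ‖fderiv ℝ (u a) x (angularField 𝕓 i j x)‖ ^ 2) r =
      (1 / 2) * ∑ i, ∑ j, ∑ a, sphereIntegral (volume : Measure 𝔼)
        (fun x => ‖fderiv ℝ (u a) x (angularField 𝕓 i j x)‖ ^ 2) r := by
    rw [← Finset.mul_sum]
    congr 1
    rw [Finset.sum_comm]
    refine Finset.sum_congr rfl fun i _ => ?_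
    rw [Finset.sum_comm]
  rw [hL, hRsum] at hsum
  linarith

end Gap

end Literature.Analysis.Calculus.MvPoly
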